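import Literature.NumberTheory.LFunctions.MauduitRivatFourierL2Split
import Literature.NumberTheory.LFunctions.MauduitRivatTypeIPrelims
import Literature.NumberTheory.LFunctions.MauduitRivatCompletion
import Mathlib.NumberTheory.Harmonic.Bounds
import HarnessLib

/-!
# Mauduit–Rivat's type-I estimate for unitary matrices (Prop. 1 of Mauduit–Rivat 2015 = Prop. 5.4 of Müllner 2017, assembled; proved)

Everything in this file is PROVED. It assembles the proof of the
type-I estimate of C. Mauduit, J. Rivat, *Prime numbers along Rudin–Shapiro sequences*, J. Eur.
Math. Soc. 17 (2015), Prop. 1 ((30)–(45), pp. 2605–2610) for unitary-matrix weights `F = U ∘ f`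
(C. Müllner, Duke Math. J. 166 (2017), Prop. 5.4) from the steps already in the tree:
the completion (31)–(32) (`MauduitRivatCompletion.lean`), the decomposition `F̂ = Ĝ₁ + Ĝ₂` by the
carry property (33)–(37) (`MauduitRivatTypeIDecomposition.lean`), the regrouping by `d = (k, m)` and
the large sieve (38)–(44) (`MauduitRivatTypeIPrelims.lean`). Differences with the printed proof
(all harmless): a single digit split `κ` with `M² ≤ k^κ` is used for every `d` (the printed `κ_d`
only cancels out), the carry exponent `η` of Müllner's Def. 4.1 is kept, and the truncation
parameter `ρ` is left free (the printed choice (45) is `ρ = γ((μ+ν)/3)`):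

* `norm_phaseSumP_shift` — `‖P_h(t − rK/m)‖ = k^{−κ} ‖∑_u e(ru/m) e(−ut/K) C(u,h)‖`;
* `sum_sum_norm_sq_coefC` — `∑_u ∑_h ‖C(u,h)‖² = k^κ d` (Parseval (25), `‖U(g)‖_F² = d`);
* `sum_norm_sq_errPart_le` — `∑_{n<K} ‖errPart n‖² ≤ C d(1+√d)² K k^{−ηρ}` (carry property, (35));
* **`typeI_avg_le`** — the heart of Prop. 1: for `Ms ⊆ [1, M]`, `M² ≤ k^κ`, `κ ≤ cλ`, `ρ < λ`,
  `K = k^{κ+λ}`, uniformly in `t`,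
  `∑_{m∈Ms} m⁻¹ ∑_{j<m} ‖F̂(t − jK/m)‖ ≤ 2√d (1 + log M)^{3/2} (k^{−γ(λ)} √(k^ρ) + (1 + √d) √(C k^{−ηρ}))`;
* **`typeI_sum_le`** — with the completion (32): for `B < K`,
  `∑_{m∈Ms} ‖∑_{A<ℓ≤B, m∣ℓ} e(ϑℓ) U(f(ℓ))‖ ≤ (2(B−A) + K(1 + log K)) · (the bound above)`,
  which is Prop. 1 / Prop. 5.4 for the block `Ms` of the type-I sum (the shape of
  `MRVaughan.blockI`).

## References
* C. Mauduit, J. Rivat, J. Eur. Math. Soc. 17 (2015), Prop. 1 and its proof, (30)–(45).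
  [MauduitRivat2015]
* C. Müllner, Duke Math. J. 166 (2017) = arXiv:1602.03042, Prop. 5.4 (pp. 26–27). [Mullner2017]
-/

noncomputable section

open Finset Complex Matrix

open scoped FourierTransform InnerProductSpace ComplexConjugate Matrix.Norms.Frobenius

namespace Literature.NumberTheory.LFunctions.MauduitRivat

variable {d : Type*} [Fintype d] [DecidableEq d] {G : Type*} [Group G]

/-! ## The unitary representation as a ring-valued homomorphism

Throughout, `U : G →* U_d` is composed with the inclusion `U_d ⊆ M_d(ℂ)`:
`(unitaryGroup d ℂ).subtype.comp U : G →* Matrix d d ℂ`, so that `umat U f = this ∘ f`. -/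

/-- `‖U(g)‖_F = √d` for the ring-valued homomorphism. [folklore] -/
theorem norm_unitarySubtype_comp_apply (U : G →* unitaryGroup d ℂ) (g : G) :
    ‖((unitaryGroup d ℂ).subtype.comp U) g‖ = Real.sqrt (Fintype.card d) :=
  norm_coe_unitary _

/-! ## The phase sums `P_h` at shifted frequencies -/

/-- **`P_h` at `t − rK/m`**: `‖P_h(t − rK/m)‖ = k^{−κ} ‖∑_{u<k^κ} e(ru/m) • (e(−ut/K) • C(u,h))‖`
(`K = k^{κ+λ}`, `k ≥ 1`) — the shape of the large-sieve step (41)–(42).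
[cite: MauduitRivat2015, (40)–(42)] -/
theorem norm_phaseSumP_shift (U : G →* unitaryGroup d ℂ) (f : ℕ → G) {k : ℕ} (hk : 0 < k)
    (κ lam ρ : ℕ) (t r m : ℝ) (h : ℕ) :
    ‖phaseSumP k κ lam ρ f ((unitaryGroup d ℂ).subtype.comp U) (t - r * ((k ^ (κ + lam) : ℕ) : ℝ) / m) h‖ =
      ((k ^ κ : ℕ) : ℝ)⁻¹ * ‖∑ u ∈ range (k ^ κ), (𝐞 (r / m * u) : ℂ) •
        ((𝐞 (-((u : ℝ) * t / (k ^ (κ + lam) : ℕ))) : ℂ) • coefC k κ ρ f ((unitaryGroup d ℂ).subtype.comp U) u h)‖ := by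
  have hK : ((k ^ (κ + lam) : ℕ) : ℝ) ≠ 0 := by positivity
  rw [phaseSumP, norm_smul, norm_inv, Complex.norm_natCast]
  congr 2
  refine sum_congr rfl fun u _ => ?_
  rw [smul_smul, coe_fourierChar_mul]
  congr 2
  field_simp
  ring

/-! ## Parseval for the coefficients `C(u, h)` -/

/-- **`∑_{u<k^κ} ∑_{h<k^ρ} ‖C(u,h)‖² = k^κ · d`** ((25) for each `u`, `‖U(g)‖_F² = d`).
[cite: MauduitRivat2015, (37) and (25) ("∑_h |c_{κ,ρ₁}(u,h)|² = 1")] -/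
theorem sum_sum_norm_sq_coefC (U : G →* unitaryGroup d ℂ) (f : ℕ → G) {k : ℕ} (hk : 0 < k)
    (κ ρ : ℕ) :
    ∑ u ∈ range (k ^ κ), ∑ h ∈ range (k ^ ρ), ‖coefC k κ ρ f ((unitaryGroup d ℂ).subtype.comp U) u h‖ ^ 2 =
      (k ^ κ : ℕ) * (Fintype.card d : ℝ) := by
  have hρ : 0 < k ^ ρ := by positivity
  have hρR : ((k ^ ρ : ℕ) : ℝ) ≠ 0 := by positivity
  have hu : ∀ u : ℕ, ∑ h ∈ range (k ^ ρ), ‖coefC k κ ρ f ((unitaryGroup d ℂ).subtype.comp U) u h‖ ^ 2 = Fintype.card d := by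
    intro u
    have hP := sum_norm_sq_dftR hρ (fun w => (((unitaryGroup d ℂ).subtype.comp U) (localQuot k κ f u w) : Matrix d d ℂ)) 0
    simp only [add_zero] at hP
    have e : ∑ h ∈ range (k ^ ρ), ‖coefC k κ ρ f ((unitaryGroup d ℂ).subtype.comp U) u h‖ ^ 2 =
        ∑ h ∈ range (k ^ ρ), ‖dftR (k ^ ρ) (fun w => (((unitaryGroup d ℂ).subtype.comp U) (localQuot k κ f u w) : Matrix d d ℂ)) (h : ℝ)‖ ^ 2 :=
      sum_congr rfl fun h _ => rfl
    rw [e, hP]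
    simp only [norm_unitarySubtype_comp_apply, Real.sq_sqrt (Nat.cast_nonneg _), sum_const, card_range, nsmul_eq_mul]
    field_simp
  rw [sum_congr rfl fun u _ => hu u, sum_const, card_range, nsmul_eq_mul]

/-! ## The error part in mean square -/

/-- **`∑_{n<K} ‖errPart n‖² ≤ C d (1+√d)² K k^{−ηρ}`** (`K = k^{κ+λ}`, `ρ < λ`): `errPart` vanishes
off the carry violations ((35)) and is bounded by `(1+√d)√d`. [cite: MauduitRivat2015, (35)–(36) and (43)–(44)] -/
theorem sum_norm_sq_errPart_le (U : G →* unitaryGroup d ℂ) {f : ℕ → G} {k : ℕ} (hk : 0 < k)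
    {η C : ℝ} (hcarry : HasCarryProperty k η C f) (κ : ℕ) {lam ρ : ℕ} (hρ : ρ < lam) :
    ∑ n ∈ range (k ^ (κ + lam)), ‖errPart k κ ρ f ((unitaryGroup d ℂ).subtype.comp U) (umat U f) n‖ ^ 2 ≤
      C * (Fintype.card d : ℝ) * (1 + Real.sqrt (Fintype.card d)) ^ 2 *
        (k ^ (κ + lam) : ℕ) * (k : ℝ) ^ (-(η * ρ)) := by
  set B : ℝ := Real.sqrt (Fintype.card d) with hB
  have hBd : ∀ g : G, ‖((unitaryGroup d ℂ).subtype.comp U) g‖ ≤ B := fun g => (norm_unitarySubtype_comp_apply U g).le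
  have hF : ∀ n, umat U f n = ((unitaryGroup d ℂ).subtype.comp U) (f n) := fun n => rfl
  set V := carryViolations k f lam κ ρ with hV
  have hkR : (0 : ℝ) < k := by exact_mod_cast hk
  -- digit split and support
  rw [sum_range_pow_add_digitSplit]
  have hterm : ∀ v ∈ range (k ^ lam), ∑ u ∈ range (k ^ κ),
      ‖errPart k κ ρ f ((unitaryGroup d ℂ).subtype.comp U) (umat U f) (u + v * k ^ κ)‖ ^ 2 ≤
        if v ∈ V then (k ^ κ : ℕ) * ((1 + B) * B) ^ 2 else 0 := by
    intro v hv
    split_ifs with hvV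
    · calc ∑ u ∈ range (k ^ κ), ‖errPart k κ ρ f ((unitaryGroup d ℂ).subtype.comp U) (umat U f) (u + v * k ^ κ)‖ ^ 2
          ≤ ∑ _u ∈ range (k ^ κ), ((1 + B) * B) ^ 2 := by
            refine sum_le_sum fun u _ => pow_le_pow_left₀ (norm_nonneg _) ?_ 2
            exact norm_errPart_le hF hBd _
        _ = (k ^ κ : ℕ) * ((1 + B) * B) ^ 2 := by rw [sum_const, card_range, nsmul_eq_mul]
    · refine le_of_eq (sum_eq_zero fun u hu => ?_)
      rw [errPart_eq_zero hk hF (mem_range.1 hu) (mem_range.1 hv) hvV, norm_zero,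
        zero_pow two_ne_zero]
  refine (sum_le_sum hterm).trans ?_
  rw [← sum_filter, filter_mem_eq_inter, sum_const, nsmul_eq_mul]
  have hcard : (((range (k ^ lam)) ∩ V).card : ℝ) ≤ C * (k : ℝ) ^ ((lam : ℝ) - η * ρ) :=
    le_trans (by exact_mod_cast card_le_card inter_subset_right) (hcarry lam κ ρ hρ)
  have hsq : ((1 + B) * B) ^ 2 = (Fintype.card d : ℝ) * (1 + B) ^ 2 := by
    rw [mul_pow, hB, Real.sq_sqrt (Nat.cast_nonneg _)]; ring
  have hpow : (k : ℝ) ^ ((lam : ℝ) - η * ρ) * (k ^ κ : ℕ) = (k ^ (κ + lam) : ℕ) * (k : ℝ) ^ (-(η * ρ)) := by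
    rw [Real.rpow_sub hkR, Real.rpow_neg hkR.le, Real.rpow_natCast]
    push_cast
    rw [pow_add]
    field_simp
  calc (((range (k ^ lam)) ∩ V).card : ℝ) * ((k ^ κ : ℕ) * ((1 + B) * B) ^ 2)
      ≤ C * (k : ℝ) ^ ((lam : ℝ) - η * ρ) * ((k ^ κ : ℕ) * ((1 + B) * B) ^ 2) :=
        mul_le_mul_of_nonneg_right hcard (by positivity)
    _ = C * (Fintype.card d : ℝ) * (1 + B) ^ 2 * ((k : ℝ) ^ ((lam : ℝ) - η * ρ) * (k ^ κ : ℕ)) := by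
        rw [hsq]; ring
    _ = _ := by rw [hpow]; ring

/-! ## Harmonic sums and small rearrangements -/

/-- `1 + log Q ≤ 1 + log M` for naturals `Q ≤ M`. [folklore] -/
theorem one_add_log_natCast_mono {Q M : ℕ} (h : Q ≤ M) : 1 + Real.log Q ≤ 1 + Real.log M := by
  rcases Nat.eq_zero_or_pos Q with hQ | hQ
  · subst hQ; simp [Real.log_natCast_nonneg]
  · have : Real.log Q ≤ Real.log M := Real.log_le_log (by exact_mod_cast hQ) (by exact_mod_cast h)
    linarith

/-- Splitting a weighted double sum of a sum. [folklore] -/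
theorem sum_inv_mul_sum_add (S : Finset ℕ) (T : ℕ → Finset ℕ) (a b : ℕ → ℕ → ℝ) :
    ∑ m ∈ S, (m : ℝ)⁻¹ * ∑ j ∈ T m, (a m j + b m j) =
      ∑ m ∈ S, (m : ℝ)⁻¹ * ∑ j ∈ T m, a m j + ∑ m ∈ S, (m : ℝ)⁻¹ * ∑ j ∈ T m, b m j := by
  rw [← sum_add_distrib]
  exact sum_congr rfl fun m _ => by rw [sum_add_distrib, mul_add]

/-- Pulling a constant out of a weighted double sum. [folklore] -/
theorem sum_inv_mul_sum_const_mul (S : Finset ℕ) (T : ℕ → Finset ℕ) (c : ℝ) (E : ℕ → ℕ → ℝ) :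
    ∑ m ∈ S, (m : ℝ)⁻¹ * ∑ j ∈ T m, c * E m j = c * ∑ m ∈ S, (m : ℝ)⁻¹ * ∑ j ∈ T m, E m j := by
  simp only [mul_sum]
  exact sum_congr rfl fun m _ => sum_congr rfl fun j _ => by ring

/-- Moving an inner finite sum outside a weighted double sum. [folklore] -/
theorem sum_inv_mul_sum_comm (S H : Finset ℕ) (T : ℕ → Finset ℕ) (c₁ c₂ : ℝ) (N : ℕ → ℕ → ℕ → ℝ) :
    ∑ m ∈ S, (m : ℝ)⁻¹ * ∑ j ∈ T m, (c₁ * ∑ h ∈ H, c₂ * N h m j) =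
      c₁ * c₂ * ∑ h ∈ H, ∑ m ∈ S, (m : ℝ)⁻¹ * ∑ j ∈ T m, N h m j := by
  have h1 : ∀ m ∈ S, (m : ℝ)⁻¹ * ∑ j ∈ T m, (c₁ * ∑ h ∈ H, c₂ * N h m j) =
      ∑ h ∈ H, ∑ j ∈ T m, c₁ * c₂ * ((m : ℝ)⁻¹ * N h m j) := by
    intro m _
    simp only [mul_sum]
    rw [sum_comm]
    exact sum_congr rfl fun h _ => sum_congr rfl fun j _ => by ring
  rw [sum_congr rfl h1, sum_comm]
  simp only [mul_sum]

/-! ## Prop. 1: the averaged Fourier transform along Farey points -/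

/-- **Mauduit–Rivat Prop. 1 / Müllner Prop. 5.4 — the core estimate (38)–(44)**: for `k ≥ 2`,
`f` with the carry property (exponent `η`, constant `C`), `F = U ∘ f` with the Fourier property
`(γ, c)`, integers `κ, λ, ρ, M` with `κ ≤ cλ`, `ρ < λ`, `M² ≤ k^κ`, a set of moduli `Ms ⊆ [1, M]`,
and `K = k^{κ+λ}`, uniformly in `t ∈ ℝ`:
`∑_{m∈Ms} m⁻¹ ∑_{j<m} ‖F̂_K(t − jK/m)‖ ≤ 2√d (1+log M)^{3/2} (k^{−γ(λ)} √(k^ρ) + (1+√d) √(C k^{−ηρ}))`.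
(Regroup by `d = (j, m)` (38)–(39), split `F̂ = Ĝ₁ + Ĝ₂` (33), bound `Ĝ₁` by the Fourier property
and the large sieve over the `k^ρ` phase sums `P_h` with Parseval (40)–(42), and `Ĝ₂` by the large
sieve and the carry count (43)–(44).) [cite: MauduitRivat2015, Prop. 1, (38)–(45); Mullner2017, Prop. 5.4] -/
theorem typeI_avg_le (U : G →* unitaryGroup d ℂ) {f : ℕ → G} {k : ℕ} (hk : 2 ≤ k)
    {η C : ℝ} (hcarry : HasCarryProperty k η C f) {γ : ℝ → ℝ} {c : ℝ}
    (hfour : HasFourierProperty k γ c (umat U f)) {κ lam ρ M : ℕ} (hκc : (κ : ℝ) ≤ c * lam)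
    (hρ : ρ < lam) (hM : M * M ≤ k ^ κ) {Ms : Finset ℕ} (hMs : Ms ⊆ Icc 1 M) (t : ℝ) :
    ∑ m ∈ Ms, (m : ℝ)⁻¹ * ∑ j ∈ range m,
        ‖dftR (k ^ (κ + lam)) (umat U f) (t - (j : ℝ) * ((k ^ (κ + lam) : ℕ) : ℝ) / m)‖ ≤
      2 * Real.sqrt (Fintype.card d) * (1 + Real.log M) * Real.sqrt (1 + Real.log M) *
        ((k : ℝ) ^ (-γ lam) * Real.sqrt ((k ^ ρ : ℕ) : ℝ) +
          (1 + Real.sqrt (Fintype.card d)) * Real.sqrt (C * (k : ℝ) ^ (-(η * ρ)))) := by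
  have hk0 : 0 < k := by omega
  have hkR : (0 : ℝ) < k := by exact_mod_cast hk0
  have hK : 0 < k ^ (κ + lam) := by positivity
  have hKR : (0 : ℝ) < (k ^ (κ + lam) : ℕ) := by exact_mod_cast hK
  have hKk : 0 < k ^ κ := by positivity
  have hKkR : (0 : ℝ) < (k ^ κ : ℕ) := by exact_mod_cast hKk
  have hKκK : k ^ κ ≤ k ^ (κ + lam) := Nat.pow_le_pow_right hk0 (Nat.le_add_right _ _)
  set sd : ℝ := Real.sqrt (Fintype.card d) with hsd
  have hsd0 : 0 ≤ sd := Real.sqrt_nonneg _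
  have hsd2 : sd ^ 2 = Fintype.card d := Real.sq_sqrt (Nat.cast_nonneg _)
  -- `C ≥ 0`
  have hC0 : 0 ≤ C := by
    have h := (Nat.cast_nonneg _).trans (hcarry lam κ ρ hρ)
    exact (mul_nonneg_iff_of_pos_right (Real.rpow_pos_of_pos hkR _)).1 h
  -- the two savings
  set A₁ : ℝ := (k : ℝ) ^ (-γ lam) * Real.sqrt ((k ^ ρ : ℕ) : ℝ) with hA₁
  set A₂ : ℝ := Real.sqrt (C * (k : ℝ) ^ (-(η * ρ))) with hA₂
  have hA₁0 : 0 ≤ A₁ := by positivity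
  have hA₂0 : 0 ≤ A₂ := Real.sqrt_nonneg _
  set LM : ℝ := Real.sqrt (1 + Real.log M) with hLM
  have hLM0 : 0 ≤ LM := Real.sqrt_nonneg _
  have hlogM0 : 0 ≤ 1 + Real.log M := by positivity
  -- Step 1: regrouping by `d = (j, m)` ((38)–(39))
  have hreg := sum_inv_sum_range_le_regroup hMs
    (fun x : ℝ => ‖dftR (k ^ (κ + lam)) (umat U f) (t - x * ((k ^ (κ + lam) : ℕ) : ℝ))‖)
    (fun x => norm_nonneg _)
  simp only [div_mul_eq_mul_div] at hreg
  refine hreg.trans ?_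
  -- the large-sieve vectors
  obtain ⟨zM, hzM⟩ : ∃ zM : ℕ → ℕ → Matrix d d ℂ, ∀ h u, zM h u =
      (𝐞 (-((u : ℝ) * t / (k ^ (κ + lam) : ℕ))) : ℂ) • coefC k κ ρ f ((unitaryGroup d ℂ).subtype.comp U) u h :=
    ⟨fun h u => (𝐞 (-((u : ℝ) * t / (k ^ (κ + lam) : ℕ))) : ℂ) • coefC k κ ρ f ((unitaryGroup d ℂ).subtype.comp U) u h,
      fun h u => rfl⟩
  obtain ⟨zE, hzE⟩ : ∃ zE : ℕ → Matrix d d ℂ, ∀ n, zE n =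
      (𝐞 (-((n : ℝ) * t / (k ^ (κ + lam) : ℕ))) : ℂ) •
        errPart k κ ρ f ((unitaryGroup d ℂ).subtype.comp U) (umat U f) n :=
    ⟨fun n => (𝐞 (-((n : ℝ) * t / (k ^ (κ + lam) : ℕ))) : ℂ) •
        errPart k κ ρ f ((unitaryGroup d ℂ).subtype.comp U) (umat U f) n, fun n => rfl⟩
  have hzMnorm : ∀ h u, ‖zM h u‖ = ‖coefC k κ ρ f ((unitaryGroup d ℂ).subtype.comp U) u h‖ := by
    intro h u; rw [hzM, norm_smul, norm_fourierChar, one_mul]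
  have hzEnorm : ∀ n, ‖zE n‖ = ‖errPart k κ ρ f ((unitaryGroup d ℂ).subtype.comp U) (umat U f) n‖ := by
    intro n; rw [hzE, norm_smul, norm_fourierChar, one_mul]
  -- Step 2: pointwise splitting `F̂ = Ĝ₁ + Ĝ₂` ((33), (40), (43))
  have hYpt : ∀ (m' j : ℕ),
      ‖dftR (k ^ (κ + lam)) (umat U f) (t - (j : ℝ) * ((k ^ (κ + lam) : ℕ) : ℝ) / m')‖ ≤
      (k : ℝ) ^ (-γ lam) * ∑ h ∈ range (k ^ ρ), (((k ^ κ : ℕ) : ℝ)⁻¹ *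
        ‖∑ u ∈ range (k ^ κ), (𝐞 ((j : ℝ) / m' * u) : ℂ) • zM h u‖) +
      ((k ^ (κ + lam) : ℕ) : ℝ)⁻¹ *
        ‖∑ n ∈ range (k ^ (κ + lam)), (𝐞 ((j : ℝ) / m' * n) : ℂ) • zE n‖ := by
    intro m' j
    have hsplit := dftR_mainPart_add (k := k) (κ := κ) (ρ := ρ) (f := f) (D := (unitaryGroup d ℂ).subtype.comp U)
      (F := umat U f) (k ^ (κ + lam)) (t - (j : ℝ) * ((k ^ (κ + lam) : ℕ) : ℝ) / m')
    have h1 : ‖dftR (k ^ (κ + lam)) (mainPart k κ ρ f ((unitaryGroup d ℂ).subtype.comp U) (umat U f))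
        (t - (j : ℝ) * ((k ^ (κ + lam) : ℕ) : ℝ) / m')‖ ≤
        (k : ℝ) ^ (-γ lam) * ∑ h ∈ range (k ^ ρ), (((k ^ κ : ℕ) : ℝ)⁻¹ *
          ‖∑ u ∈ range (k ^ κ), (𝐞 ((j : ℝ) / m' * u) : ℂ) • zM h u‖) := by
      refine (norm_dftR_mainPart_le (ρ := ρ) (f := f) (D := (unitaryGroup d ℂ).subtype.comp U) hk0 hfour hκc _).trans
        (le_of_eq ?_)
      refine congrArg ((k : ℝ) ^ (-γ lam) * ·) (sum_congr rfl fun h _ => ?_)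
      rw [norm_phaseSumP_shift U f hk0]
      simp only [← hzM]
    have h2 : ‖dftR (k ^ (κ + lam)) (errPart k κ ρ f ((unitaryGroup d ℂ).subtype.comp U) (umat U f))
        (t - (j : ℝ) * ((k ^ (κ + lam) : ℕ) : ℝ) / m')‖ =
        ((k ^ (κ + lam) : ℕ) : ℝ)⁻¹ *
          ‖∑ n ∈ range (k ^ (κ + lam)), (𝐞 ((j : ℝ) / m' * n) : ℂ) • zE n‖ := by
      rw [norm_dftR_sub_eq _ hK]
      simp only [← hzE]
    calc ‖dftR (k ^ (κ + lam)) (umat U f) (t - (j : ℝ) * ((k ^ (κ + lam) : ℕ) : ℝ) / m')‖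
        ≤ ‖dftR (k ^ (κ + lam)) (mainPart k κ ρ f ((unitaryGroup d ℂ).subtype.comp U) (umat U f))
              (t - (j : ℝ) * ((k ^ (κ + lam) : ℕ) : ℝ) / m')‖ +
            ‖dftR (k ^ (κ + lam)) (errPart k κ ρ f ((unitaryGroup d ℂ).subtype.comp U) (umat U f))
              (t - (j : ℝ) * ((k ^ (κ + lam) : ℕ) : ℝ) / m')‖ := by
          rw [← hsplit]; exact norm_add_le _ _
      _ ≤ _ := by rw [h2]; exact add_le_add h1 le_rfl
  -- Parseval for the main vectors ((42) with (25))
  have hPM : ∑ h ∈ range (k ^ ρ), ∑ u ∈ range (k ^ κ), ‖zM h u‖ ^ 2 =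
      (k ^ κ : ℕ) * (Fintype.card d : ℝ) := by
    rw [sum_comm]
    simp only [hzMnorm]
    exact sum_sum_norm_sq_coefC U f hk0 κ ρ
  -- mean square of the error vector ((44))
  have hPE : ∑ n ∈ range (k ^ (κ + lam)), ‖zE n‖ ^ 2 ≤
      C * (Fintype.card d : ℝ) * (1 + sd) ^ 2 * (k ^ (κ + lam) : ℕ) * (k : ℝ) ^ (-(η * ρ)) := by
    simp only [hzEnorm]
    exact sum_norm_sq_errPart_le U hk0 hcarry κ hρ
  -- Step 3: the bound for each `e` (large sieve (41), (43))
  have hinner : ∀ e ∈ Icc 1 M, ∑ m' ∈ Icc 1 (M / e), (m' : ℝ)⁻¹ *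
      ∑ j ∈ (range m').filter (fun j => j.Coprime m'),
        ‖dftR (k ^ (κ + lam)) (umat U f) (t - (j : ℝ) * ((k ^ (κ + lam) : ℕ) : ℝ) / m')‖ ≤
        2 * sd * LM * (A₁ + (1 + sd) * A₂) := by
    intro e _
    have hQM : M / e ≤ M := Nat.div_le_self _ _
    have hQQ : M / e * (M / e) ≤ k ^ κ := (Nat.mul_le_mul hQM hQM).trans hM
    have hQR : (((M / e : ℕ) : ℝ)) ^ 2 ≤ (k ^ κ : ℕ) := by rw [sq]; exact_mod_cast hQQ
    have hlogQ : 1 + Real.log ((M / e : ℕ) : ℝ) ≤ 1 + Real.log M := one_add_log_natCast_mono hQM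
    have hlogQ0 : 0 ≤ 1 + Real.log ((M / e : ℕ) : ℝ) := by positivity
    have hsqQ : Real.sqrt (1 + Real.log ((M / e : ℕ) : ℝ)) ≤ LM := Real.sqrt_le_sqrt hlogQ
    -- main vectors through the large sieve
    have hTM : ∀ h ∈ range (k ^ ρ), ∑ m' ∈ Icc 1 (M / e), (m' : ℝ)⁻¹ *
        ∑ j ∈ (range m').filter (fun j => j.Coprime m'),
          ‖∑ u ∈ range (k ^ κ), (𝐞 ((j : ℝ) / m' * u) : ℂ) • zM h u‖ ≤
        Real.sqrt (1 + Real.log ((M / e : ℕ) : ℝ)) *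
          Real.sqrt ((((k ^ κ : ℕ) : ℝ) + 1 + 2 * ((M / e : ℕ) : ℝ) ^ 2) *
            ∑ u ∈ range (k ^ κ), ‖zM h u‖ ^ 2) :=
      fun h _ => sum_inv_sum_coprime_norm_le' (zM h) (k ^ κ) (M / e)
    have hTE : ∑ m' ∈ Icc 1 (M / e), (m' : ℝ)⁻¹ *
        ∑ j ∈ (range m').filter (fun j => j.Coprime m'),
          ‖∑ n ∈ range (k ^ (κ + lam)), (𝐞 ((j : ℝ) / m' * n) : ℂ) • zE n‖ ≤
        Real.sqrt (1 + Real.log ((M / e : ℕ) : ℝ)) *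
          Real.sqrt ((((k ^ (κ + lam) : ℕ) : ℝ) + 1 + 2 * ((M / e : ℕ) : ℝ) ^ 2) *
            ∑ n ∈ range (k ^ (κ + lam)), ‖zE n‖ ^ 2) :=
      sum_inv_sum_coprime_norm_le' zE (k ^ (κ + lam)) (M / e)
    -- sum of the main bounds over `h` (Cauchy–Schwarz over `h`, Parseval)
    have hsumM : ∑ h ∈ range (k ^ ρ), Real.sqrt (1 + Real.log ((M / e : ℕ) : ℝ)) *
        Real.sqrt ((((k ^ κ : ℕ) : ℝ) + 1 + 2 * ((M / e : ℕ) : ℝ) ^ 2) *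
          ∑ u ∈ range (k ^ κ), ‖zM h u‖ ^ 2) ≤
        LM * (2 * (k ^ κ : ℕ) * Real.sqrt ((k ^ ρ : ℕ) : ℝ) * sd) := by
      rw [← mul_sum]
      refine mul_le_mul hsqQ ?_ (sum_nonneg fun _ _ => Real.sqrt_nonneg _) hLM0
      refine (sum_sqrt_le_sqrt_card_mul _ fun h _ => by positivity).trans ?_
      rw [card_range, ← mul_sum, hPM]
      refine (Real.sqrt_le_sqrt ?_).trans_eq (Real.sqrt_sq (by positivity))
      have h4 : (((k ^ κ : ℕ) : ℝ) + 1 + 2 * ((M / e : ℕ) : ℝ) ^ 2) ≤ 4 * (k ^ κ : ℕ) := by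
        have : (1 : ℝ) ≤ (k ^ κ : ℕ) := by exact_mod_cast hKk
        linarith
      calc ((k ^ ρ : ℕ) : ℝ) * ((((k ^ κ : ℕ) : ℝ) + 1 + 2 * ((M / e : ℕ) : ℝ) ^ 2) *
            ((k ^ κ : ℕ) * (Fintype.card d : ℝ)))
          ≤ ((k ^ ρ : ℕ) : ℝ) * ((4 * (k ^ κ : ℕ)) * ((k ^ κ : ℕ) * (Fintype.card d : ℝ))) := by
            gcongr
        _ = (2 * (k ^ κ : ℕ) * Real.sqrt ((k ^ ρ : ℕ) : ℝ) * sd) ^ 2 := by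
            rw [mul_pow, mul_pow, mul_pow, hsd2, Real.sq_sqrt (Nat.cast_nonneg _)]; ring
    -- the error bound ((44))
    have hsumE : Real.sqrt (1 + Real.log ((M / e : ℕ) : ℝ)) *
        Real.sqrt ((((k ^ (κ + lam) : ℕ) : ℝ) + 1 + 2 * ((M / e : ℕ) : ℝ) ^ 2) *
          ∑ n ∈ range (k ^ (κ + lam)), ‖zE n‖ ^ 2) ≤
        LM * (2 * ((k ^ (κ + lam) : ℕ) : ℝ) * (1 + sd) * sd * A₂) := by
      refine mul_le_mul hsqQ ?_ (Real.sqrt_nonneg _) hLM0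
      refine (Real.sqrt_le_sqrt ?_).trans_eq (Real.sqrt_sq (by positivity))
      have h4 : (((k ^ (κ + lam) : ℕ) : ℝ) + 1 + 2 * ((M / e : ℕ) : ℝ) ^ 2) ≤
          4 * ((k ^ (κ + lam) : ℕ) : ℝ) := by
        have h1 : (1 : ℝ) ≤ (k ^ (κ + lam) : ℕ) := by exact_mod_cast hK
        have h2 : (((M / e : ℕ) : ℝ)) ^ 2 ≤ (k ^ (κ + lam) : ℕ) := hQR.trans (by exact_mod_cast hKκK)
        linarith
      have hE0 : 0 ≤ ∑ n ∈ range (k ^ (κ + lam)), ‖zE n‖ ^ 2 := sum_nonneg fun _ _ => by positivity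
      calc (((k ^ (κ + lam) : ℕ) : ℝ) + 1 + 2 * ((M / e : ℕ) : ℝ) ^ 2) *
            ∑ n ∈ range (k ^ (κ + lam)), ‖zE n‖ ^ 2
          ≤ (4 * ((k ^ (κ + lam) : ℕ) : ℝ)) *
              (C * (Fintype.card d : ℝ) * (1 + sd) ^ 2 * (k ^ (κ + lam) : ℕ) * (k : ℝ) ^ (-(η * ρ))) :=
            mul_le_mul h4 hPE hE0 (by positivity)
        _ = (2 * ((k ^ (κ + lam) : ℕ) : ℝ) * (1 + sd) * sd * A₂) ^ 2 := by
            rw [mul_pow, mul_pow, mul_pow, mul_pow, hsd2, hA₂,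
              Real.sq_sqrt (mul_nonneg hC0 (Real.rpow_nonneg hkR.le _))]
            ring
    -- assemble
    calc ∑ m' ∈ Icc 1 (M / e), (m' : ℝ)⁻¹ * ∑ j ∈ (range m').filter (fun j => j.Coprime m'),
          ‖dftR (k ^ (κ + lam)) (umat U f) (t - (j : ℝ) * ((k ^ (κ + lam) : ℕ) : ℝ) / m')‖
        ≤ ∑ m' ∈ Icc 1 (M / e), (m' : ℝ)⁻¹ * ∑ j ∈ (range m').filter (fun j => j.Coprime m'),
            ((k : ℝ) ^ (-γ lam) * ∑ h ∈ range (k ^ ρ), (((k ^ κ : ℕ) : ℝ)⁻¹ *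
              ‖∑ u ∈ range (k ^ κ), (𝐞 ((j : ℝ) / m' * u) : ℂ) • zM h u‖) +
            ((k ^ (κ + lam) : ℕ) : ℝ)⁻¹ *
              ‖∑ n ∈ range (k ^ (κ + lam)), (𝐞 ((j : ℝ) / m' * n) : ℂ) • zE n‖) := by
          refine sum_le_sum fun m' _ => mul_le_mul_of_nonneg_left ?_ (by positivity)
          exact sum_le_sum fun j _ => hYpt m' j
      _ = (k : ℝ) ^ (-γ lam) * ((k ^ κ : ℕ) : ℝ)⁻¹ * ∑ h ∈ range (k ^ ρ),
            (∑ m' ∈ Icc 1 (M / e), (m' : ℝ)⁻¹ * ∑ j ∈ (range m').filter (fun j => j.Coprime m'),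
              ‖∑ u ∈ range (k ^ κ), (𝐞 ((j : ℝ) / m' * u) : ℂ) • zM h u‖) +
          ((k ^ (κ + lam) : ℕ) : ℝ)⁻¹ * ∑ m' ∈ Icc 1 (M / e), (m' : ℝ)⁻¹ *
            ∑ j ∈ (range m').filter (fun j => j.Coprime m'),
              ‖∑ n ∈ range (k ^ (κ + lam)), (𝐞 ((j : ℝ) / m' * n) : ℂ) • zE n‖ := by
          rw [sum_inv_mul_sum_add, sum_inv_mul_sum_comm, sum_inv_mul_sum_const_mul]
      _ ≤ (k : ℝ) ^ (-γ lam) * ((k ^ κ : ℕ) : ℝ)⁻¹ *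
            (LM * (2 * (k ^ κ : ℕ) * Real.sqrt ((k ^ ρ : ℕ) : ℝ) * sd)) +
          ((k ^ (κ + lam) : ℕ) : ℝ)⁻¹ * (LM * (2 * ((k ^ (κ + lam) : ℕ) : ℝ) * (1 + sd) * sd * A₂)) := by
          gcongr
          · exact (sum_le_sum hTM).trans hsumM
          · exact hTE.trans hsumE
      _ = 2 * sd * LM * (A₁ + (1 + sd) * A₂) := by
          rw [hA₁]
          field_simp
  -- Step 4: sum over `e` ((39): `∑_{e≤M} 1/e ≤ 1 + log M`)
  calc ∑ e ∈ Icc 1 M, (e : ℝ)⁻¹ * ∑ m' ∈ Icc 1 (M / e), (m' : ℝ)⁻¹ *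
        ∑ j ∈ (range m').filter (fun j => j.Coprime m'),
          ‖dftR (k ^ (κ + lam)) (umat U f) (t - (j : ℝ) * ((k ^ (κ + lam) : ℕ) : ℝ) / m')‖
      ≤ ∑ e ∈ Icc 1 M, (e : ℝ)⁻¹ * (2 * sd * LM * (A₁ + (1 + sd) * A₂)) :=
        sum_le_sum fun e he => mul_le_mul_of_nonneg_left (hinner e he) (by positivity)
    _ = (∑ e ∈ Icc 1 M, (e : ℝ)⁻¹) * (2 * sd * LM * (A₁ + (1 + sd) * A₂)) := by rw [sum_mul]
    _ ≤ (1 + Real.log M) * (2 * sd * LM * (A₁ + (1 + sd) * A₂)) := by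
        -- `∑_{e≤M} 1/e ≤ 1 + log M` (Mathlib's `harmonic_le_one_add_log`)
        have h := harmonic_le_one_add_log M
        rw [harmonic_eq_sum_Icc] at h
        push_cast at h
        exact mul_le_mul_of_nonneg_right h (by positivity)
    _ = _ := by ring

/-- **Mauduit–Rivat Prop. 1 / Müllner Prop. 5.4 (type-I sums, assembled)**: under the hypotheses
of `typeI_avg_le` and `B < K = k^{κ+λ}`, for every real `ϑ`,
`∑_{m∈Ms} ‖∑_{A<ℓ≤B, m∣ℓ} e(ϑℓ) U(f(ℓ))‖ ≤ (2(B−A) + K(1+log K)) · 2√d (1+log M)^{3/2} (k^{−γ(λ)} √(k^ρ) + (1+√d)√(C k^{−ηρ}))`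
(completion (31)–(32) + `typeI_avg_le`; the twist `e(ϑℓ)` only shifts `t`).
[cite: MauduitRivat2015, Prop. 1, (30)–(45); Mullner2017, Prop. 5.4] -/
theorem typeI_sum_le (U : G →* unitaryGroup d ℂ) {f : ℕ → G} {k : ℕ} (hk : 2 ≤ k)
    {η C : ℝ} (hcarry : HasCarryProperty k η C f) {γ : ℝ → ℝ} {c : ℝ}
    (hfour : HasFourierProperty k γ c (umat U f)) {κ lam ρ M : ℕ} (hκc : (κ : ℝ) ≤ c * lam)
    (hρ : ρ < lam) (hM : M * M ≤ k ^ κ) {Ms : Finset ℕ} (hMs : Ms ⊆ Icc 1 M) {A B : ℕ}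
    (hB : B < k ^ (κ + lam)) (ϑ : ℝ) :
    ∑ m ∈ Ms, ‖∑ ℓ ∈ (Ioc A B).filter (fun ℓ => m ∣ ℓ), (𝐞 (ϑ * ℓ) : ℂ) • umat U f ℓ‖ ≤
      (2 * ((B - A : ℕ) : ℝ) + (k ^ (κ + lam) : ℕ) * (1 + Real.log ((k ^ (κ + lam) : ℕ) : ℝ))) *
        (2 * Real.sqrt (Fintype.card d) * (1 + Real.log M) * Real.sqrt (1 + Real.log M) *
          ((k : ℝ) ^ (-γ lam) * Real.sqrt ((k ^ ρ : ℕ) : ℝ) +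
            (1 + Real.sqrt (Fintype.card d)) * Real.sqrt (C * (k : ℝ) ^ (-(η * ρ))))) := by
  have hk0 : 0 < k := by omega
  have hK : 0 < k ^ (κ + lam) := by positivity
  have hMs0 : ∀ m ∈ Ms, 0 < m := fun m hm => (mem_Icc.1 (hMs hm)).1
  refine sum_norm_sum_filter_dvd_le hK hB (Nat.cast_nonneg _) le_rfl hMs0 _ fun t => ?_
  have h := typeI_avg_le U hk hcarry hfour hκc hρ hM hMs (t - ((k ^ (κ + lam) : ℕ) : ℝ) * ϑ)
  refine le_of_eq_of_le (sum_congr rfl fun m _ => ?_) h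
  refine congrArg ((m : ℝ)⁻¹ * ·) (sum_congr rfl fun j _ => ?_)
  have e : t - (j : ℝ) * ((k ^ (κ + lam) : ℕ) : ℝ) / m - ((k ^ (κ + lam) : ℕ) : ℝ) * ϑ =
      t - ((k ^ (κ + lam) : ℕ) : ℝ) * ϑ - (j : ℝ) * ((k ^ (κ + lam) : ℕ) : ℝ) / m := by ring
  rw [dftR_fourierChar_smul, e]

end Literature.NumberTheory.LFunctions.MauduitRivat
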